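import Summits.BirchSwinnertonDyer.Rank1Residual.X11b.RouteR1HalvesPointwise
import Summits.BirchSwinnertonDyer.Rank1Residual.X11b.RouteR1LocalKernelRecord
import Summits.BirchSwinnertonDyer.Rank1Residual.X11b.RouteR1OpenInputTight
import HarnessLib

/-!
# X11b, route R1 — HALVES at `p ≥ 5`: the route's composite open input `(IMC)∘(BDP)@𝟙` SPLIT over
# Castella's PUBLISHED `L_p(f) ∈ Λ_{R₀}` into (H2) the value formula at `𝟙` (Cas18 Thm. 3.2 shape)
# and (H3) the anticyclotomic main conjecture `Ch_Λ(X_ac)·Λ_{R₀} = (L_p(f))` (erratum Thm. 1.1, OPEN)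

HONEST FRAMING (cell `b2b-bsdres`, run/shared/lean/b2b/bsd-rank1-residual/, verbatim in every
file): the goal of the cell is to DELETE the COMBINATION-SHAPED residual classes of the
Birch–Swinnerton-Dyer formula for ALL analytic-rank `≤ 1` elliptic curves over `ℚ` — "full BSD
formula for every rank `≤ 1` curve in class `C`" assembled STRICTLY from published theorems — so
that the rank-`≤ 1` remainder becomes exactly the CONSTRUCTION-SHAPED classes, which are TYPED
(missing-input `Prop`s), NOT attempted. This is not "finishing BSD". Sub-cell
`b2b-bsdres-multr1-p1` (X11b, route R1); a RESEARCH ROUTE; no claim beyond the stated class; X11b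
stays CONSTRUCTION-SHAPED; nothing here changes a label; no named fact (two `Prop`-valued class-level
SHAPES with bodies, and theorems; every result using the OPEN shape is CONDITIONAL; no `sorry`). Namespace/shape treaty with team x11b3 (OWNERS A6.3 (2),
2026-08-21T07:09Z): these are the `p ≥ 5`, route-R1, EQUALITY-shaped halves under `X11b.R1.` names;
x11b3's `p = 3` one-sided halves (`Three.…₃`, S10) are neither imported nor restated.

## What this file does (gen 20)

Gen 8 typed THE open input of route R1 at a datum as the COMPOSITE
`IMCWaldspurgerOnTreeAt p κ 𝔭 γ ι P := ∃ n, XAc.HasCharValuationAt … n ∧ n = 2·(ord_p log_ω P − 1)`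
(`AnticyclotomicLogLinks.lean`), Castella's `L_p(f)(𝟙)` being ELIMINATED between erratum Thm. 1.1
and Cas18 Thm. 3.2 because the tree had no `L_p(f)`. The tree now has the object
(`IsBDPLFunction`, lit-prim-2) and its EXISTENCE at `p ≥ 5` on semistable `E` is the registered
PUBLISHED fact A206, instantiated on R1's data in `RouteR1BDPExists.lean` (H1). Here:

* (§1–§3 are the companion file `RouteR1HalvesPointwise.lean`, over the shared receptacle
  `X11b/HalvesReceptacle.lean`:) §1 `‖1 − a·p⁻¹‖ = p` for `p ∤ a`.
* §2 the ALGEBRA OF EQUALITY (every `p`): if `f ∈ Λ` has `f(0) ≠ 0`, `(f)·R₀⟦T⟧ = (L)` and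
  `L(0) = u·((1 − a/p)·x)²` with `u ∈ R₀ˣ`, `p ∤ a`, then `x ≠ 0` and `ord_p f(0) = 2·(ord_p x − 1)`
  EXACTLY (`R1.valuation_constantCoeff_eq_of_span_map_eq`) — by norms in `ℂ_p`: the cofactor is a
  UNIT of `R₀⟦T⟧`, so `‖f(0)‖ = ‖L(0)‖ = p²‖x‖²`.
* §3 pointwise ON TREE OBJECTS (every `p`, every `ι : K →+* ℚ_p`; `log_{ω_E} P = Halves.logOmega W p ι P
  ∈ ℚ_p`, whose `ord_p` is `padicLogOrd`), the two SHAPES at a frame `L`: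
  **`R1.BDPValueAtOneOnTreeAt`** (H2: `∃ u ∈ R₀ˣ, L(𝟙) = u·((1 − a_p(E) p⁻¹)·log_ω P)²`, Cas18
  Thm. 3.2 — PUB shape) and **`R1.IMCEqOnTreeAt`** (H3: `Ch_Λ(X_ac^∅(E[p^∞]))·R₀⟦T⟧ = (L)`, erratum
  Thm. 1.1 — OPEN shape), and **`R1.imcWaldspurgerOnTreeAt_of_halves`**: CTL₀ (`HasCharValuationAt
  n`, a THEOREM on route R1 since gen 18) ∧ H3 ∧ H2 ⟹ `IMCWaldspurgerOnTreeAt` with the same `n`.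
* §4 CLASS LEVEL at `p ≥ 5`: the typed inputs **`R1.BDPValueOnTree W p`** (H2 at every R1 datum,
  every anticyclotomic `(κ, γ)`, every embedding datum `ι'` and every frame
  `IsBDPLFunction ι' 𝔭_{ι'} κ γ f Ω_K Ω_p L`) and **`R1.IMCEqOnTree W p`** (H3 likewise), and
  **`R1.openInputOnTreeAt_of_halves`**: on a SEMISTABLE pair, `R1OpenInputOnTreeAt W p` ⟸ H2-typed
  ∧ H3-typed, given the PUBLISHED facts `hBDP` (A206, H1), `hmod`, `hGZK` and the CITED facts of
  the control theorem (`hPT hPT2 hEP hcd hBr`) — at EVERY degree-one `𝔭 ∣ p`, because every such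
  `𝔭` is `𝔭_ι` or `𝔭_{ι ∘ conj}` (`eq_primeOfEmbeddingDatum_or_eq_trans_starRingAut`); hence
  **`R1.bsdp_of_halves_final`**: `BSD_p` on semistable `R1Population ∩ {r_an = 1}` from 8 PUB
  (incl. A206) + 5 cited + H2 (PUB shape) + H3 (OPEN), for a fixed embedding datum `ι` (through
  the tightness theorem `R1.openInputOnTreeAt_iff_bsdp_final` of gen 19).

So at `p ≥ 5` on semistable R1 pairs the route's OPEN input is EXACTLY erratum Thm. 1.1 for
Castella's published `L_p(f)` — "`Ch_Λ(X_ac(E[p^∞]))Λ_{R₀} = (L_p(f))`" (⇐ [FW21, Thm. 4.41],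
PREPRINT) — and the value formula is a separately typed PUBLISHED shape (Cas18 Thm. 3.2, whose
printed proof at `p ∣ N` is [cas-split] Thm. 2.11, split `p ≥ 5`: x11b3 REFEREE §2 H3/H4 police
rows record the non-split reading). CONDITIONAL; X11b stays CONSTRUCTION-SHAPED; no label change.

References: [Castella2018] Thm. 2.3, Thm. 3.1, Thm. 3.2, §5 (arXiv:1704.06608 pp. 5, 9, 12);
[Castella2018Erratum] Thm. 1.1 (p. 1); [FouquetWan2021] Thm. 4.41; [CastellaHsieh2018] §3.3.
-/

noncomputable section

open scoped Classical

open WeierstrassCurve NumberField IsDedekindDomain Field PowerSeries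
open Literature.NumberTheory.EllipticCurves Literature.NumberTheory.EllipticCurves.GreenbergSelmer
open Literature.NumberTheory.EllipticCurves.ModularForms
open Literature.NumberTheory.EllipticCurves.Rank1Residual
open Literature.NumberTheory.EllipticCurves.Rank1Residual.Typed
open Literature.NumberTheory.GaloisRepresentations
open Literature.NumberTheory.GaloisCohomology
open Summit.BirchSwinnertonDyer.Rank1Residual.X11b.AcSelmer
open Summit.BirchSwinnertonDyer.Rank1Residual.X11b.Halves

namespace Summit.BirchSwinnertonDyer.Rank1Residual.X11b

/-! ### §4 Class level at `p ≥ 5`: the typed halves and the open input from them -/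

section ClassLevel

variable (W : WeierstrassCurve ℚ) [W.IsElliptic] [W.IsGloballyMinimal] (p : ℕ) [Fact p.Prime]

/-- **H2 on route R1's data (PUB shape, Cas18 Thm. 3.2), typed.** For every datum of
`R1OpenInputOnTreeAt W p` (A′-hypotheses, `r_an = 1`, non-split multiplicative `q ≠ p` with `E[p]`
ramified, erratum field `K` for `q` with [Cas20 §2.5] standing hypotheses, Heegner datum of level
`N_E` with `p ∤ c`, its Heegner point `P` of infinite order), every newform `f` of `E` (level `N_E`),
every anticyclotomic `(κ, γ)`, every embedding datum `ι' : ℚ̄_p ≃ ℂ` and infinite place `w₀`, and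
every frame `(Ω_K, Ω_p, L)` with `IsBDPLFunction ι' 𝔭_{ι'} κ γ f Ω_K Ω_p L` at the induced prime
`𝔭_{ι'} = primeOfEmbeddingDatum p ι' w₀.embedding`: `L(𝟙) = u·((1 − a_p(E) p⁻¹)·log_{ω_E} P)²` for a
unit `u ∈ R₀ˣ`, `log` through THE embedding `embAt K p 𝔭_{ι'}` (degree one on an erratum field,
`degreeOne_primeOfEmbeddingDatum_of_isErratumField`). A predicate on `(W, p)`; nothing asserted;
consumed as a hypothesis. [cite: Castella2018, Thm. 3.2 (arXiv:1704.06608 p. 9) (shape only; nothing asserted)] -/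
def R1.BDPValueOnTree : Prop :=
  ∀ [NeZero (W.conductorNorm ℤ)] (q : ℕ) [Fact q.Prime] (K : Type) [Field K] [NumberField K]
    (Dt : ModularParametrizationData W (W.conductorNorm ℤ))
    (H : HeegnerDatum (W.conductorNorm ℤ) (NumberField.discr K)) (ιK : K →+* ℂ)
    (P : (W.baseChange K).toAffine.Point) (hE : ErratumHypotheses W p), W.analyticRank = 1 →
    ∀ (hqp : q ≠ p), Mult W q → ¬ W.HasSplitMultiplicativeReductionAtPrime q →
    ¬ p ∣ padicValInt q W.minimalDiscriminantInt → ∀ (hK : IsErratumField W K q),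
    Cas20Standing K p (W.conductorNorm ℤ / p) →
    WeierstrassCurve.Affine.Point.map ιK.toRatAlgHom P = heegnerPointComplex Dt H →
    ¬ (p : ℤ) ∣ Dt.c → ¬ IsOfFinAddOrder P →
    ∀ (f : CuspForm (CongruenceSubgroup.Gamma0 (W.conductorNorm ℤ)) 2), IsNewformOf W f →
    ∀ (κ : ZpExtension K p), κ.IsAnticyclotomic →
      ∀ (γ : Field.absoluteGaloisGroup K) [Fact (κ.IsTopGenerator γ)] (ι' : PadicAlgCl p ≃+* ℂ)
        (w₀ : InfinitePlace K) (ΩK : ℂ) (Ωp : (unrIntegers p)ˣ) (L : UnrSeries p),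
        IsBDPLFunction ι' (primeOfEmbeddingDatum p ι' w₀.embedding) κ γ f ΩK
          ((Ωp : unrIntegers p) : ℂ_[p]) L →
        R1.BDPValueAtOneOnTreeAt W p
          (embAt K p (primeOfEmbeddingDatum p ι' w₀.embedding)
            (natCast_mem_primeOfEmbeddingDatum p ι' w₀.embedding)
            (degreeOne_primeOfEmbeddingDatum_of_isErratumField hK
              (dvd_conductorNorm_of_mult hE.2.1) hqp ι' w₀.embedding).1
            (degreeOne_primeOfEmbeddingDatum_of_isErratumField hK
              (dvd_conductorNorm_of_mult hE.2.1) hqp ι' w₀.embedding).2)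
          P L (W.LFunction p)

/-- **H3 on route R1's data (OPEN shape, erratum Thm. 1.1), typed.** For the same data, newform,
`(κ, γ)`, embedding datum `ι'`, `w₀` and frame `L` with `IsBDPLFunction ι' 𝔭_{ι'} κ γ f Ω_K Ω_p L`:
`Ch_Λ(X_ac^∅(E[p^∞]))·R₀⟦T⟧ = (L)` for the constructed `X_ac` at `𝔭_{ι'}` (`R1.IMCEqOnTreeAt`). THE
OPEN input of route R1 at `p ≥ 5` in its sharpest typed form — the anticyclotomic main conjecture
for Castella's PUBLISHED `L_p(f)`; printed derivation: erratum Thm. 1.1 ⇐ Thm. 2.3 ⇐ [FW21,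
Thm. 4.41] (PREPRINT) + Hida theory + [Cas20, Thm. 2.11]. A predicate on `(W, p)`; NEVER a theorem
in this cell; every result using it is CONDITIONAL. [claim: Castella2018Erratum, status: under-review] -/
def R1.IMCEqOnTree : Prop :=
  ∀ [NeZero (W.conductorNorm ℤ)] (q : ℕ) [Fact q.Prime] (K : Type) [Field K] [NumberField K]
    (Dt : ModularParametrizationData W (W.conductorNorm ℤ))
    (H : HeegnerDatum (W.conductorNorm ℤ) (NumberField.discr K)) (ιK : K →+* ℂ)
    (P : (W.baseChange K).toAffine.Point), ErratumHypotheses W p → W.analyticRank = 1 →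
    q ≠ p → Mult W q → ¬ W.HasSplitMultiplicativeReductionAtPrime q →
    ¬ p ∣ padicValInt q W.minimalDiscriminantInt → IsErratumField W K q →
    Cas20Standing K p (W.conductorNorm ℤ / p) →
    WeierstrassCurve.Affine.Point.map ιK.toRatAlgHom P = heegnerPointComplex Dt H →
    ¬ (p : ℤ) ∣ Dt.c → ¬ IsOfFinAddOrder P →
    ∀ (f : CuspForm (CongruenceSubgroup.Gamma0 (W.conductorNorm ℤ)) 2), IsNewformOf W f →
    ∀ (κ : ZpExtension K p), κ.IsAnticyclotomic →
      ∀ (γ : Field.absoluteGaloisGroup K) [Fact (κ.IsTopGenerator γ)] (ι' : PadicAlgCl p ≃+* ℂ)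
        (w₀ : InfinitePlace K) (ΩK : ℂ) (Ωp : (unrIntegers p)ˣ) (L : UnrSeries p),
        IsBDPLFunction ι' (primeOfEmbeddingDatum p ι' w₀.embedding) κ γ f ΩK
          ((Ωp : unrIntegers p) : ℂ_[p]) L →
        R1.IMCEqOnTreeAt W p κ (primeOfEmbeddingDatum p ι' w₀.embedding) γ L

variable {W p}

/-- **Route R1's open input FROM THE HALVES, on a semistable pair at `p ≥ 5`.** Given the PUBLISHED
facts `hBDP` (Cas18 Thm. 3.1 = A206: H1, BDP-EXISTS), `hmod` (modularity: the newform), `hGZK`, the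
CITED cohomological facts of the control theorem (`hPT` Poitou–Tate for Selmer structures, `hPT2`
`Ш¹ ↔ Ш¹(dual)`, `hEP` local Euler–Poincaré, `hcd` `cd_p ≤ 2`, `hBr` Brink) — which make
`R1ControlOnTreeAt W p` a THEOREM (gen 18) —, a SEMISTABLE pair, ONE embedding datum
`ι : ℚ̄_p ≃ ℂ`, and the two TYPED inputs H2 (`R1.BDPValueOnTree`, PUB shape) and H3
(`R1.IMCEqOnTree`, OPEN): `R1OpenInputOnTreeAt W p` — at EVERY anticyclotomic `(κ, γ)` and EVERY
degree-one `𝔭 ∣ p`, since every such `𝔭` is `𝔭_ι` or `𝔭_{ι ∘ conj}`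
(`eq_primeOfEmbeddingDatum_or_eq_trans_starRingAut`) and H1–H3 are available at both data.
CONDITIONAL on H3 (open) and H2 (PUB shape). [cite: Castella2018, Thms. 2.3, 3.1, 3.2 and §5 (arXiv:1704.06608 pp. 5, 9, 12)]
[cite: Castella2018Erratum, Thm. 1.1 (p. 1)] -/
theorem R1.openInputOnTreeAt_of_halves (hBDP : castella2018_exists_isBDPLFunction)
    (hmod : exists_isNewformOf) (hGZK : rank_eq_analyticRank_of_analyticRank_le_one)
    (hPT : ∀ (K : Type) [Field K] [NumberField K], poitouTate_selmerStructure_duality K)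
    (hPT2 : ∀ (K : Type) [Field K] [NumberField K], poitouTate_sha_tateDual K)
    (hEP : ∀ (K : Type) [Field K] [NumberField K] (v : HeightOneSpectrum (𝓞 K)),
      localEulerPoincareCharacteristic (v.adicCompletion K))
    (hcd : fieldCdLE_two_of_numberField)
    (hBr : ∀ (K : Type) [Field K] [NumberField K] (p : ℕ) [Fact p.Prime],
      ZpExtension.decomp_not_le_kerSubgroup_of_isAnticyclotomic K p)
    (ι : PadicAlgCl p ≃+* ℂ) (hss : Semistable W) (h2 : R1.BDPValueOnTree W p)
    (h3 : R1.IMCEqOnTree W p) : R1OpenInputOnTreeAt W p := by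
  intro _ q _ K _ _ Dt H ιK P hE hr hqp hmq hns hvq hK hCas hP hc hinf κ hκ γ _ 𝔭 h𝔭 he hf
  have hC : R1ControlOnTreeAt W p :=
    r1ControlOnTreeAt_of_poitouTateAtoms_of_anticyclotomicDecomposition W p hBr
      (r1PoitouTateAtomsAt_of_twoAtoms W p hPT hEP
        (r1TwoAtomsAt_of_baseSelmerCount W p hPT hPT2 hEP hcd
          (r1BaseSelmerCountAt_of_facts W p hGZK hmod hPT hEP)))
  obtain ⟨n, hn, -⟩ := hC q K Dt H ιK P hE hr hqp hmq hns hvq hK hCas hP hc hinf κ hκ γ 𝔭 h𝔭 he hf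
  obtain ⟨f, hfW⟩ := hmod W
  obtain ⟨w₀⟩ := (inferInstance : Nonempty (InfinitePlace K))
  have hnd : ¬ (p : ℤ) ∣ W.LFunction p := R1.not_dvd_lFunction_of_mult hfW hE.2.1
  -- every degree-one prime above `p` is induced by `ι` or by `ι ∘ conj`
  have key : ∀ ι' : PadicAlgCl p ≃+* ℂ, 𝔭 = primeOfEmbeddingDatum p ι' w₀.embedding →
      IMCWaldspurgerOnTreeAt p κ 𝔭 γ (embAt K p 𝔭 h𝔭 he hf) P := by
    intro ι' h𝔭eq
    subst h𝔭eq
    obtain ⟨ΩK, Ωp, L, -, hL⟩ :=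
      exists_isBDPLFunction_of_erratumHypotheses hBDP ι' hfW hE hss hqp hK κ hκ γ w₀
    exact R1.imcWaldspurgerOnTreeAt_of_halves hn
      (h3 q K Dt H ιK P hE hr hqp hmq hns hvq hK hCas hP hc hinf f hfW κ hκ γ ι' w₀ ΩK Ωp L hL)
      hnd
      (h2 q K Dt H ιK P hE hr hqp hmq hns hvq hK hCas hP hc hinf f hfW κ hκ γ ι' w₀ ΩK Ωp L hL)
  rcases eq_primeOfEmbeddingDatum_or_eq_trans_starRingAut p ι hK.1 w₀ h𝔭 with h | h
  · exact key ι h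
  · exact key _ h

/-- **Route R1 — statement of record WITH THE HALVES (gen 20), semistable pairs, `p ≥ 5`.** For every
globally minimal SEMISTABLE elliptic `W/ℚ` and prime `p` on `R1Population` with `ord_{s=1}L(E,s) =
1`: `BSD(E,p)`, from EIGHT PUBLISHED named facts (Gross–Zagier I.7.3, GZK, Skinner 2016 Thm. C,
modularity, Cai–Shu–Tian, Friedberg–Hoffstein, Mazur's Manin — and Castella 2018 Thm. 3.1 =
`hBDP`, the EXISTENCE of `L_p(f)`), the FIVE CITED cohomological facts of gen 18, one
embedding datum `ι`, the PUB-shaped value formula H2 (`R1.BDPValueOnTree`, Cas18 Thm. 3.2) and the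
ONE OPEN input H3 (`R1.IMCEqOnTree`: erratum Thm. 1.1 — the anticyclotomic IMC for Castella's
published `L_p(f)` — ⇐ [FW21, Thm. 4.41], PREPRINT). Compared with `R1.bsdp_of_onTree_final` (gen 18)
the composite `R1OpenInputOnTreeAt` is replaced by its two halves over the published object; the
existence half is discharged. CONDITIONAL; deletes nothing; X11b stays CONSTRUCTION-SHAPED; no label
change. [cite: Castella2018, §5 (arXiv:1704.06608 p. 12)] [cite: Castella2018Erratum, Thm. 1.1, Thm. A′ (p. 1)] -/
theorem R1.bsdp_of_halves_final
    (hGZ : GrossZagier1986_thm_I_7_3) (hGZK : rank_eq_analyticRank_of_analyticRank_le_one)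
    (hSk : Skinner2016.thmC_padicValRat_bsd_rank_zero) (hmod : exists_isNewformOf)
    (hCST : CaiShuTian2014.thm11_trivialChar)
    (hFH : friedbergHoffstein_exists_twist_ne_zero_ramifiedAt)
    (hMaz : mazur_not_dvd_maninConstant_of_odd) (hBDP : castella2018_exists_isBDPLFunction)
    (hPT : ∀ (K : Type) [Field K] [NumberField K], poitouTate_selmerStructure_duality K)
    (hPT2 : ∀ (K : Type) [Field K] [NumberField K], poitouTate_sha_tateDual K)
    (hEP : ∀ (K : Type) [Field K] [NumberField K] (v : HeightOneSpectrum (𝓞 K)),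
      localEulerPoincareCharacteristic (v.adicCompletion K))
    (hcd : fieldCdLE_two_of_numberField)
    (hBr : ∀ (K : Type) [Field K] [NumberField K] (p : ℕ) [Fact p.Prime],
      ZpExtension.decomp_not_le_kerSubgroup_of_isAnticyclotomic K p)
    (ι : PadicAlgCl p ≃+* ℂ) (hss : Semistable W) (h2 : R1.BDPValueOnTree W p)
    (h3 : R1.IMCEqOnTree W p) (hW : R1Population W p) (hr : W.analyticRank = 1) : BSDp W p :=
  (R1.openInputOnTreeAt_iff_bsdp_final (W := W) (p := p) hGZ hGZK hSk hmod hCST hFH hMaz hPT hPT2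
      hEP hcd hBr hW hr).mp
    (R1.openInputOnTreeAt_of_halves hBDP hmod hGZK hPT hPT2 hEP hcd hBr ι hss h2 h3)

end ClassLevel

end Summit.BirchSwinnertonDyer.Rank1Residual.X11b

end
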